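import Summits.AtomisticToContinuum.Crystallization.Theorems.ChargedEnergyGapExcisionTails
import Literature.MathematicalPhysics.StatisticalMechanics.SeparatedShellSums
import HarnessLib

/-!
# Charged energy gap — lens-3 g63, part P-Z₂: the SHARP far tail (thin spherical shells instead of dyadic ones)

Cell `decomp-a2c`, seat lens-3, generation 63, part P-Z₂ (after P-Z₁ `ChargedEnergyGapLabelledCovering`).  ELEMENTARY·PROVED.
P-V (`ChargedEnergyGapExcisionTails`) bounds the excision functional of a source all of whose excised partners are at distance `≥ R` by
the tree's DYADIC-shell constant `1024/(s³R³)`; at the record (`s = 3/5`, far threshold `R = 3ϱ/8 = 60`) that is `2.2·10⁻²` per source,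
thirty times the shell budget `A_T = C_T/(λτ²) = 1/1350` of the far-residue bound `FarResidueBound` (P-Y).  This file replaces the dyadic
shells by shells of a fixed THICKNESS `h` counted with the tree's annulus packing lemma
`Literature…card_le_of_separated_of_mem_shell` (`(2R₂/s + 1)³ − max(2R₁/s − 1, 0)³` points in `R₁ ≤ d ≤ R₂`) and sums the shells by an
exact telescoping (`3h·(R + (k+1)h)⁻⁴ ≤ (R + kh)⁻³ − (R + (k+1)h)⁻³`):
* `inv_pow_four_le_telescope`, `sum_range_inv_pow_four_le` — the telescoping layer-cake `Σ_{k ≤ K} (R + kh)⁻⁴ ≤ R⁻⁴ + R⁻³/(3h)`;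
* `shell_card_factor_le` — the annulus count is `≤ 3(2h/s + 2)(2(A + h)/s + 1)²`;
* ★★ `sum_inv_pow_six_le_sharp` — for a finite `s`-separated set at distance `≥ R > 0` from `p` and any shell thickness `h > 0`:
  `Σ |a − p|⁻⁶ ≤ (2h/s + 2)·(2/s)²·((R + h + s/2)/R)²·(3/R⁴ + 1/(hR³))`; `tsum_inv_pow_six_le_sharp` — the same for the points of an
  arbitrary `s`-separated set (summability from the tree);
* ★★ `excisionSum_le_far_sharp` — P-V's far tail with this constant; `record_sharp_tail` — at the record dials with `h = 12/5`:
  the constant is `< 1/3800`, below the shell budget `1/1350` of `FarResidueBound` with margin `2.8` and below the transition budget `1/45`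
  (P-V's dyadic `1024/(s³·60³) = 1024/46656 ≈ 1/45.6` is ABOVE `1/1350`): the input of the SELF-CHARGING of shell / transition sources in the
  g64 attribution of the far residue (seat HANDOFF §E (S), §F).
-/

noncomputable section

open scoped Classical

open Literature.MathematicalPhysics.StatisticalMechanics Literature.Geometry.DiscreteGeometry
open Summit.AtomisticToContinuum.Crystallization.Theses.PricedLinkCensus
open Summit.AtomisticToContinuum.Crystallization.Theorems.ChargedEnergyGapNegative

namespace Summit.AtomisticToContinuum.Crystallization.Theorems.ChargedEnergyGapChartDial

section SharpTail

/-- Telescoping step: `3(b − a)·b⁻⁴ ≤ a⁻³ − b⁻³` for `0 < a ≤ b` (`b⁴ − 4a³b + 3a⁴ = (b − a)²(b² + 2ab + 3a²) ≥ 0`). -/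
theorem inv_pow_four_le_telescope {a b : ℝ} (ha : 0 < a) (hab : a ≤ b) :
    3 * (b - a) * (b⁻¹) ^ 4 ≤ (a⁻¹) ^ 3 - (b⁻¹) ^ 3 := by
  have hb : 0 < b := ha.trans_le hab
  have hkey : 0 ≤ (b - a) ^ 2 * (b ^ 2 + 2 * a * b + 3 * a ^ 2) := by positivity
  rw [inv_pow, inv_pow, inv_pow, ← sub_nonneg]
  have h1 : (a ^ 3)⁻¹ - (b ^ 3)⁻¹ - 3 * (b - a) * (b ^ 4)⁻¹ = (b ^ 4 - 4 * a ^ 3 * b + 3 * a ^ 4) / (a ^ 3 * b ^ 4) := by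
    field_simp
    ring
  rw [h1]
  apply div_nonneg _ (by positivity)
  nlinarith [hkey]

/-- The telescoping layer-cake: `Σ_{k ≤ K} (R + kh)⁻⁴ ≤ R⁻⁴ + (R⁻³ − (R + Kh)⁻³)/(3h) ≤ R⁻⁴ + R⁻³/(3h)`. -/
theorem sum_range_inv_pow_four_le_telescope {R h : ℝ} (hR : 0 < R) (hh : 0 < h) (K : ℕ) :
    ∑ k ∈ Finset.range (K + 1), ((R + k * h)⁻¹) ^ 4 ≤ (R⁻¹) ^ 4 + ((R⁻¹) ^ 3 - ((R + K * h)⁻¹) ^ 3) / (3 * h) := by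
  induction K with
  | zero => simp
  | succ K ih =>
    rw [Finset.sum_range_succ]
    have hK : 0 < R + K * h := by positivity
    have hstep := inv_pow_four_le_telescope hK (show R + K * h ≤ R + (K + 1 : ℕ) * h by push_cast; nlinarith)
    have h3 : ((R + (K + 1 : ℕ) * h)⁻¹) ^ 4 ≤ (((R + K * h)⁻¹) ^ 3 - ((R + (K + 1 : ℕ) * h)⁻¹) ^ 3) / (3 * h) := by
      rw [le_div_iff₀ (by positivity)]
      have : (R + (K + 1 : ℕ) * h) - (R + K * h) = h := by push_cast; ring
      rw [this] at hstep
      linarith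
    calc ∑ k ∈ Finset.range (K + 1), ((R + k * h)⁻¹) ^ 4 + ((R + (K + 1 : ℕ) * h)⁻¹) ^ 4
        ≤ (R⁻¹) ^ 4 + ((R⁻¹) ^ 3 - ((R + K * h)⁻¹) ^ 3) / (3 * h)
          + (((R + K * h)⁻¹) ^ 3 - ((R + (K + 1 : ℕ) * h)⁻¹) ^ 3) / (3 * h) := add_le_add ih h3
      _ = (R⁻¹) ^ 4 + ((R⁻¹) ^ 3 - ((R + (K + 1 : ℕ) * h)⁻¹) ^ 3) / (3 * h) := by ring

/-- Integral-test bound for the inverse fourth powers on an arithmetic progression: `Σ_{k ≤ K} (R + k h)⁻⁴ ≤ R⁻⁴ + R⁻³/(3h)` (telescoping `3(b−a)b⁻⁴ ≤ a⁻³ − b⁻³`). [folklore] (docstring added by the landing lane) -/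
theorem sum_range_inv_pow_four_le {R h : ℝ} (hR : 0 < R) (hh : 0 < h) (K : ℕ) :
    ∑ k ∈ Finset.range (K + 1), ((R + k * h)⁻¹) ^ 4 ≤ (R⁻¹) ^ 4 + (R⁻¹) ^ 3 / (3 * h) := by
  refine (sum_range_inv_pow_four_le_telescope hR hh K).trans ?_
  have h0 : 0 ≤ ((R + K * h)⁻¹) ^ 3 := by positivity
  have h3h : 0 < 3 * h := by positivity
  have : ((R⁻¹) ^ 3 - ((R + K * h)⁻¹) ^ 3) / (3 * h) ≤ (R⁻¹) ^ 3 / (3 * h) :=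
    div_le_div_of_nonneg_right (by linarith) h3h.le
  linarith

/-- The annulus count factor: `(2(A + h)/s + 1)³ − max(2A/s − 1, 0)³ ≤ 3(2h/s + 2)(2(A + h)/s + 1)²` (`0 ≤ A`, `0 ≤ h`, `0 < s`). -/
theorem shell_card_factor_le {s A h : ℝ} (hs : 0 < s) (hA : 0 ≤ A) (hh : 0 ≤ h) :
    (2 * (A + h) / s + 1) ^ 3 - (max (2 * A / s - 1) 0) ^ 3 ≤ 3 * (2 * h / s + 2) * (2 * (A + h) / s + 1) ^ 2 := by
  set x : ℝ := 2 * (A + h) / s + 1 with hx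
  set y : ℝ := 2 * A / s - 1 with hy
  have hAs : 0 ≤ 2 * A / s := by positivity
  have hhs : 0 ≤ 2 * h / s := by positivity
  have hxy : x - y = 2 * h / s + 2 := by rw [hx, hy]; ring
  have hx1 : 1 ≤ x := by
    have : x = 2 * A / s + 2 * h / s + 1 := by rw [hx]; ring
    rw [this]; linarith
  by_cases hy0 : 0 ≤ y
  · rw [max_eq_left hy0]
    have hyx : y ≤ x := by linarith
    have : x ^ 3 - y ^ 3 = (x - y) * (x ^ 2 + x * y + y ^ 2) := by ring
    rw [this, hxy]
    have h2 : x ^ 2 + x * y + y ^ 2 ≤ 3 * x ^ 2 := by nlinarith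
    nlinarith
  · push Not at hy0
    rw [max_eq_right hy0.le]
    have hx3 : x ≤ 3 * (2 * h / s + 2) := by
      have : x = 2 * A / s + 2 * h / s + 1 := by rw [hx]; ring
      have hA1 : 2 * A / s < 1 := by rw [hy] at hy0; linarith
      rw [this]; linarith
    have : x ^ 3 = x * x ^ 2 := by ring
    rw [zero_pow three_ne_zero, sub_zero, this]
    exact mul_le_mul_of_nonneg_right hx3 (by positivity)

/-- One shell of thickness `h`: a finite `s`-separated set in `A ≤ dist · p ≤ A + h` (`R ≤ A`) has
`Σ |a − p|⁻⁶ ≤ 3(2h/s + 2)(2/s)²((R + h + s/2)/R)²·A⁻⁴`. -/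
theorem sum_inv_pow_six_le_shell (F : Finset E3) (p : E3) {s h R A : ℝ} (hs : 0 < s) (hh : 0 < h) (hR : 0 < R) (hRA : R ≤ A)
    (hsep : ∀ a ∈ F, ∀ b ∈ F, a ≠ b → s ≤ dist a b) (hmem : ∀ a ∈ F, A ≤ dist a p ∧ dist a p ≤ A + h) :
    ∑ a ∈ F, (dist a p)⁻¹ ^ 6 ≤ 3 * (2 * h / s + 2) * (2 / s) ^ 2 * ((R + h + s / 2) / R) ^ 2 * (A⁻¹) ^ 4 := by
  have hA : 0 < A := hR.trans_le hRA
  -- (1) the annulus count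
  have hcard : (F.card : ℝ) ≤ (2 * (A + h) / s + 1) ^ 3 - (max (2 * A / s - 1) 0) ^ 3 := by
    have h := card_le_of_separated_of_mem_shell F p hs (by positivity : (0 : ℝ) ≤ A + h) (by linarith : A ≤ A + h) hmem hsep
    rwa [finrank_euclideanSpace_fin] at h
  have hcard' : (F.card : ℝ) ≤ 3 * (2 * h / s + 2) * (2 * (A + h) / s + 1) ^ 2 :=
    hcard.trans (shell_card_factor_le hs hA.le hh.le)
  -- (2) each term
  have hterm : ∀ a ∈ F, (dist a p)⁻¹ ^ 6 ≤ (A⁻¹) ^ 6 := by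
    intro a ha
    have hlo := (hmem a ha).1
    exact pow_le_pow_left₀ (inv_nonneg.2 dist_nonneg) (inv_anti₀ hA hlo) _
  have hsum : ∑ a ∈ F, (dist a p)⁻¹ ^ 6 ≤ F.card * (A⁻¹) ^ 6 := by
    have := Finset.sum_le_card_nsmul F (fun a => (dist a p)⁻¹ ^ 6) _ hterm
    rwa [nsmul_eq_mul] at this
  -- (3) (2(A+h)/s + 1)² = (2/s)²(A + h + s/2)² ≤ (2/s)²·γ²·A²
  have hγ : 2 * (A + h) / s + 1 ≤ 2 / s * ((R + h + s / 2) / R) * A := by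
    have hx : 2 * (A + h) / s + 1 = 2 / s * (A + h + s / 2) := by field_simp
    rw [hx, mul_assoc]
    refine mul_le_mul_of_nonneg_left ?_ (by positivity)
    rw [div_mul_eq_mul_div, le_div_iff₀ hR]
    nlinarith
  have hγ2 : (2 * (A + h) / s + 1) ^ 2 ≤ (2 / s * ((R + h + s / 2) / R) * A) ^ 2 :=
    pow_le_pow_left₀ (by positivity) hγ 2
  have h6 : (A⁻¹) ^ 6 = (A⁻¹) ^ 4 * (A ^ 2)⁻¹ := by rw [inv_pow, inv_pow, ← mul_inv, ← pow_add]
  calc ∑ a ∈ F, (dist a p)⁻¹ ^ 6 ≤ F.card * (A⁻¹) ^ 6 := hsum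
    _ ≤ 3 * (2 * h / s + 2) * (2 * (A + h) / s + 1) ^ 2 * (A⁻¹) ^ 6 := by gcongr
    _ ≤ 3 * (2 * h / s + 2) * (2 / s * ((R + h + s / 2) / R) * A) ^ 2 * (A⁻¹) ^ 6 := by gcongr
    _ = 3 * (2 * h / s + 2) * (2 / s) ^ 2 * ((R + h + s / 2) / R) ^ 2 * (A⁻¹) ^ 4 * (A ^ 2 * (A ^ 2)⁻¹) := by rw [h6]; ring
    _ = 3 * (2 * h / s + 2) * (2 / s) ^ 2 * ((R + h + s / 2) / R) ^ 2 * (A⁻¹) ^ 4 := by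
      rw [mul_inv_cancel₀ (by positivity), mul_one]

/-- ★★ **SHARP FAR TAIL (finite form).**  A finite `s`-separated set all of whose points are at distance `≥ R > 0` from `p` has, for every
shell thickness `h > 0`, `Σ |a − p|⁻⁶ ≤ (2h/s + 2)(2/s)²((R + h + s/2)/R)²(3/R⁴ + 1/(hR³))` — shells `R + kh ≤ d < R + (k+1)h` counted by the
annulus packing and summed by telescoping.  At `s = 3/5`, `h = 12/5`, `R = 60` the constant is `< 1/3800` (dyadic: `1024/(s³R³) ≈ 1/46`). -/
theorem sum_inv_pow_six_le_sharp (F : Finset E3) (p : E3) {s h R : ℝ} (hs : 0 < s) (hh : 0 < h) (hR : 0 < R)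
    (hsep : ∀ a ∈ F, ∀ b ∈ F, a ≠ b → s ≤ dist a b) (hfar : ∀ a ∈ F, R ≤ dist a p) :
    ∑ a ∈ F, (dist a p)⁻¹ ^ 6 ≤ (2 * h / s + 2) * (2 / s) ^ 2 * ((R + h + s / 2) / R) ^ 2 * (3 / R ^ 4 + 1 / (h * R ^ 3)) := by
  -- shell index
  set idx : E3 → ℕ := fun a => ⌊(dist a p - R) / h⌋₊ with hidx
  have hshell : ∀ a ∈ F, R + (idx a) * h ≤ dist a p ∧ dist a p ≤ R + (idx a) * h + h := by
    intro a ha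
    have ht : 0 ≤ (dist a p - R) / h := div_nonneg (by linarith [hfar a ha]) hh.le
    have h1 : ((idx a : ℕ) : ℝ) ≤ (dist a p - R) / h := Nat.floor_le ht
    have h2 : (dist a p - R) / h < (idx a : ℕ) + 1 := Nat.lt_floor_add_one _
    rw [le_div_iff₀ hh] at h1
    rw [div_lt_iff₀ hh] at h2
    constructor <;> nlinarith
  set K : ℕ := F.sup idx with hK
  have hmaps : ∀ a ∈ F, idx a ∈ Finset.range (K + 1) := fun a ha =>
    Finset.mem_range.2 (Nat.lt_succ_of_le (Finset.le_sup (f := idx) ha))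
  rw [← Finset.sum_fiberwise_of_maps_to hmaps]
  set c : ℝ := 3 * (2 * h / s + 2) * (2 / s) ^ 2 * ((R + h + s / 2) / R) ^ 2 with hc
  -- each fibre is one shell
  have hfib : ∀ k ∈ Finset.range (K + 1), ∑ a ∈ F with idx a = k, (dist a p)⁻¹ ^ 6 ≤ c * ((R + k * h)⁻¹) ^ 4 := by
    intro k _
    refine sum_inv_pow_six_le_shell _ p hs hh hR (by nlinarith : R ≤ R + k * h) ?_ ?_
    · intro a ha b hb hab
      exact hsep a (Finset.mem_filter.1 ha).1 b (Finset.mem_filter.1 hb).1 hab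
    · intro a ha
      obtain ⟨haF, hak⟩ := Finset.mem_filter.1 ha
      have := hshell a haF
      rw [hak] at this
      exact this
  calc ∑ k ∈ Finset.range (K + 1), ∑ a ∈ F with idx a = k, (dist a p)⁻¹ ^ 6
      ≤ ∑ k ∈ Finset.range (K + 1), c * ((R + k * h)⁻¹) ^ 4 := Finset.sum_le_sum hfib
    _ = c * ∑ k ∈ Finset.range (K + 1), ((R + k * h)⁻¹) ^ 4 := by rw [Finset.mul_sum]
    _ ≤ c * ((R⁻¹) ^ 4 + (R⁻¹) ^ 3 / (3 * h)) := by
      have hc0 : 0 ≤ c := by positivity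
      exact mul_le_mul_of_nonneg_left (sum_range_inv_pow_four_le hR hh K) hc0
    _ = (2 * h / s + 2) * (2 / s) ^ 2 * ((R + h + s / 2) / R) ^ 2 * (3 / R ^ 4 + 1 / (h * R ^ 3)) := by
      rw [hc, inv_pow, inv_pow]
      field_simp

/-- The sharp tail constant, as a function of separation `s`, shell thickness `h` and inner radius `R`. -/
theorem sharpTailConst_pos {s h R : ℝ} (hs : 0 < s) (hh : 0 < h) (hR : 0 < R) :
    0 < (2 * h / s + 2) * (2 / s) ^ 2 * ((R + h + s / 2) / R) ^ 2 * (3 / R ^ 4 + 1 / (h * R ^ 3)) := by positivity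

/-- ★ Summable form over an arbitrary `s`-separated set (summability is the tree's `ExcessDecayLiouville.summable_inv_pow_of_separated`). -/
theorem tsum_inv_pow_six_le_sharp {Y : Set E3} (p : E3) {s h R : ℝ} (hs : 0 < s) (hh : 0 < h) (hsR : s ≤ R)
    (hsep : ∀ a ∈ Y, ∀ b ∈ Y, a ≠ b → s ≤ dist a b) :
    ∑' a : {a : E3 // a ∈ Y ∧ R ≤ dist a p}, (dist (a : E3) p)⁻¹ ^ (3 + 3) ≤
      (2 * h / s + 2) * (2 / s) ^ 2 * ((R + h + s / 2) / R) ^ 2 * (3 / R ^ 4 + 1 / (h * R ^ 3)) := by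
  have hR : 0 < R := hs.trans_le hsR
  refine (ExcessDecayLiouville.summable_inv_pow_of_separated p (k := 3) (by norm_num) hs hsR hsep).tsum_le_of_sum_le fun u => ?_
  have h := sum_inv_pow_six_le_sharp (u.map (Function.Embedding.subtype _)) p hs hh hR ?_ ?_
  · rwa [Finset.sum_map] at h
  · intro a ha b hb hab
    simp only [Finset.mem_map, Function.Embedding.coe_subtype] at ha hb
    obtain ⟨a', -, rfl⟩ := ha
    obtain ⟨b', -, rfl⟩ := hb
    exact hsep _ a'.2.1 _ b'.2.1 hab
  · intro a ha
    simp only [Finset.mem_map, Function.Embedding.coe_subtype] at ha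
    obtain ⟨a', -, rfl⟩ := ha
    exact a'.2.2

end SharpTail

section SharpExcision

variable (P : PeriodicConfiguration 3) (X : Set E3) (y : E3)

/-- ★★ **SHARP FAR TAIL OF THE EXCISION FUNCTIONAL.**  For an `s`-separated reference, if every excised point farther than `1` from `y`
is at distance `≥ R` (`1 ≤ R`, `s ≤ R`), then for every shell thickness `h > 0`
`E_X(y) ≤ (2h/s + 2)(2/s)²((R + h + s/2)/R)²(3/R⁴ + 1/(hR³))` (P-V `excisionSum_le_far` with the thin-shell constant). -/
theorem excisionSum_le_far_sharp {s : ℝ} (hP : IsSeparatedRef s P) (hs : 0 < s) {h R : ℝ} (hh : 0 < h) (hsR : s ≤ R) (hR : 1 ≤ R)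
    (hX : ∀ z ∈ P.points, z ∈ X → z ≠ y → 1 < dist y z → R ≤ dist y z) :
    excisionSum P X y ≤ (2 * h / s + 2) * (2 / s) ^ 2 * ((R + h + s / 2) / R) ^ 2 * (3 / R ^ 4 + 1 / (h * R ^ 3)) := by
  rw [excisionSum_inter_far]
  set X' : Set E3 := X ∩ {z | 1 < dist y z} with hX'def
  have hX' : ∀ z ∈ P.points, z ∈ X' → z ≠ y → R ≤ dist y z := fun z hz hzX hzy => hX z hz hzX.1 hzy hzX.2
  have hsep : ∀ a ∈ P.points, ∀ b ∈ P.points, a ≠ b → s ≤ dist a b := hP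
  have hT := tsum_inv_pow_six_le_sharp (Y := P.points) y hs hh hsR hsep
  have hTs := ExcessDecayLiouville.summable_inv_pow_of_separated (X := P.points) y (k := 3) (by norm_num) hs hsR hsep
  have hind : Set.indicator {z : E3 | z ∈ P.points ∧ z ≠ y} (fun z : E3 => if R ≤ dist z y then (dist z y)⁻¹ ^ (3 + 3) else (0 : ℝ)) =
      Set.indicator {a : E3 | a ∈ P.points ∧ R ≤ dist a y} (fun a : E3 => (dist a y)⁻¹ ^ (3 + 3)) := by
    funext x
    simp only [Set.indicator_apply, Set.mem_setOf_eq]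
    by_cases hx : x ∈ P.points
    · by_cases hRx : R ≤ dist x y
      · have hxy : x ≠ y := by
          rintro rfl
          rw [dist_self] at hRx
          linarith
        simp [hx, hxy, hRx]
      · by_cases hxy : x = y <;> simp [hx, hxy, hRx]
    · simp [hx]
  have hsumS : Summable fun z : {z : E3 // z ∈ P.points ∧ z ≠ y} =>
      (if R ≤ dist (z : E3) y then (dist (z : E3) y)⁻¹ ^ (3 + 3) else (0 : ℝ)) := by
    have h1 := (summable_subtype_iff_indicator (s := {a : E3 | a ∈ P.points ∧ R ≤ dist a y})
      (f := fun a : E3 => (dist a y)⁻¹ ^ (3 + 3))).1 hTs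
    rw [← hind] at h1
    exact (summable_subtype_iff_indicator (s := {z : E3 | z ∈ P.points ∧ z ≠ y})
      (f := fun z : E3 => if R ≤ dist z y then (dist z y)⁻¹ ^ (3 + 3) else (0 : ℝ))).2 h1
  calc excisionSum P X' y
      ≤ ∑' z : {z : E3 // z ∈ P.points ∧ z ≠ y}, (if R ≤ dist (z : E3) y then (dist (z : E3) y)⁻¹ ^ (3 + 3) else (0 : ℝ)) :=
        Summable.tsum_le_tsum (excisionSummand_le_far P X' y hR hX') (summable_excisionSummand P X' y) hsumS
    _ = ∑' x : E3, Set.indicator {z : E3 | z ∈ P.points ∧ z ≠ y}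
          (fun z : E3 => if R ≤ dist z y then (dist z y)⁻¹ ^ (3 + 3) else (0 : ℝ)) x :=
        tsum_subtype {z : E3 | z ∈ P.points ∧ z ≠ y} (fun z : E3 => if R ≤ dist z y then (dist z y)⁻¹ ^ (3 + 3) else (0 : ℝ))
    _ = ∑' x : E3, Set.indicator {a : E3 | a ∈ P.points ∧ R ≤ dist a y} (fun a : E3 => (dist a y)⁻¹ ^ (3 + 3)) x := by rw [hind]
    _ = ∑' a : {a : E3 // a ∈ P.points ∧ R ≤ dist a y}, (dist (a : E3) y)⁻¹ ^ (3 + 3) :=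
        (tsum_subtype {a : E3 | a ∈ P.points ∧ R ≤ dist a y} (fun a : E3 => (dist a y)⁻¹ ^ (3 + 3))).symm
    _ ≤ _ := hT

/-- The version with every excised point at distance `≥ R` (no condition on short bonds). -/
theorem excisionSum_le_farAll_sharp {s : ℝ} (hP : IsSeparatedRef s P) (hs : 0 < s) {h R : ℝ} (hh : 0 < h) (hsR : s ≤ R) (hR : 1 ≤ R)
    (hX : ∀ z ∈ P.points, z ∈ X → z ≠ y → R ≤ dist y z) :
    excisionSum P X y ≤ (2 * h / s + 2) * (2 / s) ^ 2 * ((R + h + s / 2) / R) ^ 2 * (3 / R ^ 4 + 1 / (h * R ^ 3)) :=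
  excisionSum_le_far_sharp P X y hP hs hh hsR hR (fun z hz hzX hzy _ => hX z hz hzX hzy)

/-- ★ **RECORD NUMBERS.**  At the record separation `s = 3/5` and far threshold `R = 3ϱ/8 = 60` (`ϱ = 160`), with shell thickness `h = 12/5`,
the sharp tail constant is `< 1/3800`: below the SHELL budget `A_T = C_T/(λτ²) = 1/1350` of `FarResidueBound` (margin `> 2.8`) and the
TRANSITION budget `A_χ = Cχ/(λτ²) = 1/45`; P-V's dyadic constant `1024/(s³R³) = 1024/46656` is `> 1/1350` (it is `≈ 1/45.6`).  With the strain prefactor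
`λτ²·(1/3800) = (1/2)(3/100)²/3800 < 1.2·10⁻⁷ < C_T = 1/3000000`. -/
theorem record_sharp_tail :
    (2 * (12 / 5 : ℝ) / (3 / 5) + 2) * (2 / (3 / 5)) ^ 2 * ((60 + 12 / 5 + (3 / 5) / 2) / 60) ^ 2 * (3 / 60 ^ 4 + 1 / ((12 / 5) * 60 ^ 3))
        < 1 / 3800 ∧
      (1 : ℝ) / 3800 < 1 / 1350 ∧ (1 : ℝ) / 3800 < 1 / 45 ∧ (1 : ℝ) / 1350 < 1024 / ((3 / 5) ^ 3 * 60 ^ 3) ∧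
      (1 / 2 : ℝ) * (3 / 100) ^ 2 * (1 / 3800) < 1 / 3000000 ∧ (3 : ℝ) * 160 / 8 = 60 := by
  refine ⟨by norm_num, by norm_num, by norm_num, by norm_num, by norm_num, by norm_num⟩

/-- ★ The record far tail of one source: every excised partner at distance `≥ 60` from `y` in a `3/5`-separated reference ⇒ `E_X(y) < 1/3800`. -/
theorem excisionSum_le_far_record (hP : IsSeparatedRef (3 / 5) P) (hX : ∀ z ∈ P.points, z ∈ X → z ≠ y → 60 ≤ dist y z) :
    excisionSum P X y ≤ 1 / 3800 := by
  have h := excisionSum_le_farAll_sharp P X y hP (by norm_num) (h := 12 / 5) (R := 60) (by norm_num) (by norm_num) (by norm_num) hX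
  exact h.trans (le_of_lt record_sharp_tail.1)

end SharpExcision

end Summit.AtomisticToContinuum.Crystallization.Theorems.ChargedEnergyGapChartDial

end
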